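import Summits.BirchSwinnertonDyer.BirchSwinnertonDyer.Theorems.CumulativeHeegnerLeopoldtCumulativeHeegnerInclusionAtThreeLayerControlCurve
import Summits.BirchSwinnertonDyer.BirchSwinnertonDyer.Theorems.CumulativeHeegnerLeopoldtCumulativeHeegnerInclusionAtThreeCellNoThreeTorsion
import Literature.NumberTheory.EllipticCurves.HeegnerPointsImaginaryQuadraticProofs
import HarnessLib

/-!
# Crux K1 `CumulativeHeegnerInclusionAtThree` (stmt-BirchSwinnertonDyer-24198) / crux A (stmt-26896): the
# port [P-ctl] — anticyclotomic CONTROL AT EVERY LAYER `K_n`, III: the LEOPOLDT CELL at `p = 3`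
# (every `ℤ₃`-extension `κ` of the Heegner field `K`, every generator `γ`, every `𝔭′ ∋ 3`, every `Σ`, every `n`)

Width seat bsd-line-chl-k1-p1-w8 (`--supports stmt-BirchSwinnertonDyer-24198`). THEOREMS ONLY (no definition,
no named fact, no `sorry`); imports no `Theses` module (route-independent). Instance of II
(`…LayerControlCurve.layerControl_of_bad_descent` / `…_of_bad_subset`) on the crux's cell — `E/ℚ` of class O6
at `3` (wild additive) with a rational line `Φ ≤ E[3]` NON-ANOMALOUS at `3`, `N = N_E`, `K` imaginary quadratic
with the Heegner hypothesis for `N` — where BOTH torsion inputs of the control theorem are THEOREMS of the cell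
(width seat -w2, p615628 `…CellNoThreeTorsion`): `E(K_∞)[3^∞] = 0` (`cell_fixedPoints_kerSubgroup_eq_bot`) and
`E(K_{∞,w})[3^∞] = 0` above every `𝔭′ ∋ 3` (`cell_fixedPoints_decomp_inf_kerSubgroup_eq_bot`), for EVERY
`ℤ₃`-extension `κ` of `K` (anticyclotomic included). Hence, on the Leopoldt cell, at EVERY layer `n` of EVERY
`ℤ₃`-tower `K_∞/K` with topological generator `γ`, for every `𝔭′ ∋ 3` and every `Σ`:

* `cell_layerControl_injective` — `s_n : Sel_{𝔭′}^Σ(K_n, E[3^∞]) → Sel_{𝔭′}^Σ(K_∞, E[3^∞])` (restriction) is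
  INJECTIVE;
* `cell_layerControl_of_bad_descent` — and hits every `conj_{γ^{3ⁿ}}`-fixed class (uniquely) as soon as the away
  conditions descend to `K_n` at the finite `v ∤ 3`, `v ∉ Σ`, of BAD reduction not split completely in `K_∞`
  (the good places, the split places, the places above `3` and the infinite places are discharged);
* `cell_layerControl_of_bad_subset` — with NO residual input when `Σ ⊇ {v ∤ 3 of bad reduction}`:
  **`Sel_{𝔭′}^Σ(K_n, E[3^∞]) ≅ Sel_{𝔭′}^Σ(K_∞, E[3^∞])[ω_n]` for all `n`** (`ω_n = (1+T)^{3ⁿ} − 1`, `1 + T ↦ conj_γ`).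

For K1's own module `X_{∅,0}(𝔭′)` (`Σ = ∅`) the one remaining input at layer `n` is thus the local kernel
`ker r_{n,v} = H¹(K_{∞,η}/K_{n,v}, E(K_{∞,η})[3^∞])` at the bad `v ∣ N`, `v ∤ 3` (all split in `K`, finitely
decomposed in `K_∞^{ac}`): the Tamagawa-type group whose dual is the `C_n` of the (LT) layer data
(`…LayerTowerControl.forall_pow_mul_mem_map_fittingIdeal_sup_layer`, p637962). Crux A (26896) and K1 (24198)
stay OPEN; BSD is not proved by any of this; no summit statement is proved by this seat.

References: [GreenbergLNM1716] §3 Lemmas 3.1–3.3 and p. 90 (Thm. 1.2 at every layer);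
[Castella2018Erratum] Thm. 1.1 (iv), Lemma 2.1; [GreenbergVatsal2000] §2 p. 28; [JetchevSkinnerWan2017] §3.3
(shape only).
-/

set_option linter.dupNamespace false
set_option autoImplicit false

noncomputable section

open scoped Classical

namespace Summit.BirchSwinnertonDyer.BirchSwinnertonDyer.Theorems.CumulativeHeegnerInclusionAtThreeLayerControlCell

open NumberField IsDedekindDomain Field WeierstrassCurve
open Literature.NumberTheory.EllipticCurves Literature.NumberTheory.EllipticCurves.GreenbergSelmer
open Literature.NumberTheory.GaloisRepresentations
open Summit.BirchSwinnertonDyer.Rank1Residual.X11b Summit.BirchSwinnertonDyer.Rank1Residual.X11b.AcSelmer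
open Summit.BirchSwinnertonDyer.BirchSwinnertonDyer.Theorems.CumulativeHeegnerInclusionAtThreeLayerControl
open Summit.BirchSwinnertonDyer.BirchSwinnertonDyer.Theorems.CumulativeHeegnerInclusionAtThreeLayerControlCurve
open Summit.BirchSwinnertonDyer.BirchSwinnertonDyer.Theorems.CumulativeHeegnerInclusionAtThreeCellNoThreeTorsion

/-- **On the Leopoldt cell, `s_n` is INJECTIVE at every layer of every `ℤ₃`-tower**: for `E/ℚ` of class O6 at
`3` with a non-anomalous rational line, `N = N_E`, `K` imaginary quadratic Heegner for `N`, EVERY `ℤ₃`-extension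
`κ` of `K`, every `n`: `res_{K_n→K_∞} : H¹(K_n, E[3^∞]) → H¹(K_∞, E[3^∞])` is injective (`E(K_∞)[3^∞] = 0` on the
cell, `cell_fixedPoints_kerSubgroup_eq_bot`, fed to II). [cite: GreenbergLNM1716, §3 Lemma 3.1 (p. 86)]
[cite: Castella2018Erratum, Lemma 2.1] -/
theorem cell_layerControl_injective :
    ∀ (W : WeierstrassCurve ℚ) [W.IsElliptic] [W.IsGloballyMinimal] (N : ℕ) [NeZero N] (K : Type) [Field K]
      [NumberField K], Summit.BirchSwinnertonDyer.Rank1Residual.Additive.ClassO6 W 3 →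
      (∃ Φ : AddSubgroup (WeierstrassCurve.geomTorsion W ((3 : ℕ) : ℤ)),
        Literature.NumberTheory.EllipticCurves.Rank1Residual.IsRationalLine W 3 Φ ∧
        ∀ (v : IsDedekindDomain.HeightOneSpectrum (NumberField.RingOfIntegers ℚ)),
          ((3 : ℕ) : NumberField.RingOfIntegers ℚ) ∈ v.asIdeal → ∀ 𝔓 ∈ v.primesAbove,
          ¬ (∀ g ∈ 𝔓.decompositionSubgroup (Field.absoluteGaloisGroup ℚ), ∀ P ∈ Φ, g • P = P) ∧
          ¬ (∀ g ∈ 𝔓.decompositionSubgroup (Field.absoluteGaloisGroup ℚ),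
              ∀ P : WeierstrassCurve.geomTorsion W ((3 : ℕ) : ℤ), g • P - P ∈ Φ)) →
      W.conductorNorm ℤ = N → Literature.NumberTheory.EllipticCurves.IsImaginaryQuadratic K →
      Literature.NumberTheory.EllipticCurves.SatisfiesHeegnerHypothesis N K →
      ∀ (κ : Literature.NumberTheory.EllipticCurves.ZpExtension K 3) (n : ℕ),
      haveI : (W.baseChange K).IsElliptic := inferInstanceAs (W.map (algebraMap ℚ K)).IsElliptic
      Function.Injective ((W.baseChange K).resOfLe 3 (κ.kerSubgroup_le_layerSubgroup n)) := by
  intro W _ _ N _ K _ _ hO6 hline hN hK hHg κ n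
  haveI : Fact (Nat.Prime 3) := ⟨Nat.prime_three⟩
  haveI hEK : (W.baseChange K).IsElliptic := inferInstanceAs (W.map (algebraMap ℚ K)).IsElliptic
  exact resOfLe_layer_injective_of_fixedPoints_eq_bot κ (W.baseChange K) n
    (cell_fixedPoints_kerSubgroup_eq_bot W N K hO6 hline hN hK hHg κ)

/-- **Layer-`n` control on the Leopoldt cell modulo BAD-place descent.** Same cell; EVERY `ℤ₃`-extension `κ`
of `K` with topological generator `γ`, every prime `𝔭′ ∋ 3` of `K`, every `Σ`, every `n`. If the away conditions
descend to `K_n` at the finite `v ∤ 3`, `v ∉ Σ`, of bad reduction not split completely in `K_∞` (hypothesis `hS`;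
good / split / infinite places and the places above `3` need nothing: II §1–§2, I §5, and `E(K_{∞,w})[3^∞] = 0`
from `cell_fixedPoints_decomp_inf_kerSubgroup_eq_bot`), then `s_n` is injective and every class of
`Sel_{𝔭′}^Σ(K_∞, E[3^∞])` fixed by `conj_{γ^{3ⁿ}}` is the restriction of a UNIQUE class of `Sel_{𝔭′}^Σ(K_n, E[3^∞])`.
[cite: GreenbergLNM1716, §3 p. 90 (Thm. 1.2 from Lemmas 3.1, 3.2, 3.5)] [cite: Castella2018Erratum, Thm. 1.1 (iv)] -/
theorem cell_layerControl_of_bad_descent :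
    ∀ (W : WeierstrassCurve ℚ) [W.IsElliptic] [W.IsGloballyMinimal] (N : ℕ) [NeZero N] (K : Type) [Field K]
      [NumberField K], Summit.BirchSwinnertonDyer.Rank1Residual.Additive.ClassO6 W 3 →
      (∃ Φ : AddSubgroup (WeierstrassCurve.geomTorsion W ((3 : ℕ) : ℤ)),
        Literature.NumberTheory.EllipticCurves.Rank1Residual.IsRationalLine W 3 Φ ∧
        ∀ (v : IsDedekindDomain.HeightOneSpectrum (NumberField.RingOfIntegers ℚ)),
          ((3 : ℕ) : NumberField.RingOfIntegers ℚ) ∈ v.asIdeal → ∀ 𝔓 ∈ v.primesAbove,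
          ¬ (∀ g ∈ 𝔓.decompositionSubgroup (Field.absoluteGaloisGroup ℚ), ∀ P ∈ Φ, g • P = P) ∧
          ¬ (∀ g ∈ 𝔓.decompositionSubgroup (Field.absoluteGaloisGroup ℚ),
              ∀ P : WeierstrassCurve.geomTorsion W ((3 : ℕ) : ℤ), g • P - P ∈ Φ)) →
      W.conductorNorm ℤ = N → Literature.NumberTheory.EllipticCurves.IsImaginaryQuadratic K →
      Literature.NumberTheory.EllipticCurves.SatisfiesHeegnerHypothesis N K →
      ∀ (κ : Literature.NumberTheory.EllipticCurves.ZpExtension K 3) (γ : Field.absoluteGaloisGroup K),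
        κ.IsTopGenerator γ →
      ∀ (𝔭' : IsDedekindDomain.HeightOneSpectrum (NumberField.RingOfIntegers K)),
        ((3 : ℕ) : NumberField.RingOfIntegers K) ∈ 𝔭'.asIdeal →
      ∀ (S : Set (IsDedekindDomain.HeightOneSpectrum (NumberField.RingOfIntegers K))) (n : ℕ),
      haveI : (W.baseChange K).IsElliptic := inferInstanceAs (W.map (algebraMap ℚ K)).IsElliptic
      (∀ c : (W.baseChange K).subgroupH1 3 (κ.layerSubgroup n),
        (W.baseChange K).resOfLe 3 (κ.kerSubgroup_le_layerSubgroup n) c ∈ selmerAc (W.baseChange K) 3 κ 𝔭' S →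
          ∀ v : HeightOneSpectrum (𝓞 K), ((3 : ℕ) : 𝓞 K) ∉ v.asIdeal → v ∉ S →
            ¬ decomp v ≤ κ.kerSubgroup → ¬ (W.baseChange K).HasGoodReductionAt v →
              ∀ σ : absoluteGaloisGroup K,
                (W.baseChange K).conjH1 3 (κ.layerSubgroup n) σ c ∈
                  awayKer (κ.layerSubgroup n) ((W.baseChange K).geomPrimaryTorsion 3) v) →
      Function.Injective ((W.baseChange K).resOfLe 3 (κ.kerSubgroup_le_layerSubgroup n)) ∧
        ∀ x ∈ selmerAc (W.baseChange K) 3 κ 𝔭' S,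
          (W.baseChange K).conjH1 3 κ.kerSubgroup (γ ^ 3 ^ n) x = x →
            ∃! c : (W.baseChange K).subgroupH1 3 (κ.layerSubgroup n),
              c ∈ selmerOver (κ.layerSubgroup n) ((W.baseChange K).geomPrimaryTorsion 3) 3 𝔭' S ∧
                (W.baseChange K).resOfLe 3 (κ.kerSubgroup_le_layerSubgroup n) c = x := by
  intro W _ _ N _ K _ _ hO6 hline hN hK hHg κ γ hγ 𝔭' h𝔭' S n hS
  haveI : Fact (Nat.Prime 3) := ⟨Nat.prime_three⟩
  haveI hEK : (W.baseChange K).IsElliptic := inferInstanceAs (W.map (algebraMap ℚ K)).IsElliptic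
  haveI : IsTotallyComplex K := IsImaginaryQuadratic.isTotallyComplex hK
  exact layerControl_of_bad_descent κ (W.baseChange K) 𝔭' S n hγ
    (cell_fixedPoints_kerSubgroup_eq_bot W N K hO6 hline hN hK hHg κ)
    (cell_fixedPoints_decomp_inf_kerSubgroup_eq_bot W N K hO6 hline hN hK hHg κ 𝔭' h𝔭') hS

/-- **EXACT layer-`n` control on the Leopoldt cell, `Σ ⊇ {bad v ∤ 3}`, NO residual input.** Same cell; EVERY
`ℤ₃`-extension `κ` of `K` with topological generator `γ`, every `𝔭′ ∋ 3`, every `Σ` containing the finite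
`v ∤ 3` of bad reduction of `E_K`, EVERY layer `n`: `s_n : Sel_{𝔭′}^Σ(K_n, E[3^∞]) → Sel_{𝔭′}^Σ(K_∞, E[3^∞])[ω_n]`
is injective and hits every `conj_{γ^{3ⁿ}}`-fixed class — `Sel_{𝔭′}^Σ(K_n, E[3^∞]) ≅ Sel_{𝔭′}^Σ(K_∞, E[3^∞])^{Γ_n}`
along the whole tower. (For K1's `Σ = ∅` the remaining input is the Tamagawa-type kernel at the bad
`v ∣ N`, `v ∤ 3` — `cell_layerControl_of_bad_descent`.) [cite: GreenbergLNM1716, §3 Lemmas 3.1–3.3 and p. 90]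
[cite: Castella2018Erratum, Thm. 1.1 (iv), Lemma 2.1] [cite: JetchevSkinnerWan2017, §3.3 (shape only)] -/
theorem cell_layerControl_of_bad_subset :
    ∀ (W : WeierstrassCurve ℚ) [W.IsElliptic] [W.IsGloballyMinimal] (N : ℕ) [NeZero N] (K : Type) [Field K]
      [NumberField K], Summit.BirchSwinnertonDyer.Rank1Residual.Additive.ClassO6 W 3 →
      (∃ Φ : AddSubgroup (WeierstrassCurve.geomTorsion W ((3 : ℕ) : ℤ)),
        Literature.NumberTheory.EllipticCurves.Rank1Residual.IsRationalLine W 3 Φ ∧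
        ∀ (v : IsDedekindDomain.HeightOneSpectrum (NumberField.RingOfIntegers ℚ)),
          ((3 : ℕ) : NumberField.RingOfIntegers ℚ) ∈ v.asIdeal → ∀ 𝔓 ∈ v.primesAbove,
          ¬ (∀ g ∈ 𝔓.decompositionSubgroup (Field.absoluteGaloisGroup ℚ), ∀ P ∈ Φ, g • P = P) ∧
          ¬ (∀ g ∈ 𝔓.decompositionSubgroup (Field.absoluteGaloisGroup ℚ),
              ∀ P : WeierstrassCurve.geomTorsion W ((3 : ℕ) : ℤ), g • P - P ∈ Φ)) →
      W.conductorNorm ℤ = N → Literature.NumberTheory.EllipticCurves.IsImaginaryQuadratic K →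
      Literature.NumberTheory.EllipticCurves.SatisfiesHeegnerHypothesis N K →
      ∀ (κ : Literature.NumberTheory.EllipticCurves.ZpExtension K 3) (γ : Field.absoluteGaloisGroup K),
        κ.IsTopGenerator γ →
      ∀ (𝔭' : IsDedekindDomain.HeightOneSpectrum (NumberField.RingOfIntegers K)),
        ((3 : ℕ) : NumberField.RingOfIntegers K) ∈ 𝔭'.asIdeal →
      ∀ (S : Set (IsDedekindDomain.HeightOneSpectrum (NumberField.RingOfIntegers K))) (n : ℕ),
      haveI : (W.baseChange K).IsElliptic := inferInstanceAs (W.map (algebraMap ℚ K)).IsElliptic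
      (∀ v : HeightOneSpectrum (𝓞 K), ((3 : ℕ) : 𝓞 K) ∉ v.asIdeal →
        ¬ (W.baseChange K).HasGoodReductionAt v → v ∈ S) →
      Function.Injective ((W.baseChange K).resOfLe 3 (κ.kerSubgroup_le_layerSubgroup n)) ∧
        ∀ x ∈ selmerAc (W.baseChange K) 3 κ 𝔭' S,
          (W.baseChange K).conjH1 3 κ.kerSubgroup (γ ^ 3 ^ n) x = x →
            ∃! c : (W.baseChange K).subgroupH1 3 (κ.layerSubgroup n),
              c ∈ selmerOver (κ.layerSubgroup n) ((W.baseChange K).geomPrimaryTorsion 3) 3 𝔭' S ∧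
                (W.baseChange K).resOfLe 3 (κ.kerSubgroup_le_layerSubgroup n) c = x := by
  intro W _ _ N _ K _ _ hO6 hline hN hK hHg κ γ hγ 𝔭' h𝔭' S n hbad
  haveI : Fact (Nat.Prime 3) := ⟨Nat.prime_three⟩
  haveI hEK : (W.baseChange K).IsElliptic := inferInstanceAs (W.map (algebraMap ℚ K)).IsElliptic
  haveI : IsTotallyComplex K := IsImaginaryQuadratic.isTotallyComplex hK
  exact layerControl_of_bad_subset κ (W.baseChange K) 𝔭' S n hγ
    (cell_fixedPoints_kerSubgroup_eq_bot W N K hO6 hline hN hK hHg κ)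
    (cell_fixedPoints_decomp_inf_kerSubgroup_eq_bot W N K hO6 hline hN hK hHg κ 𝔭' h𝔭') hbad

end Summit.BirchSwinnertonDyer.BirchSwinnertonDyer.Theorems.CumulativeHeegnerInclusionAtThreeLayerControlCell

end
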